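import Literature.NumberTheory.EllipticCurves.AdditiveReductionRamifiedTorsionProofs
import Literature.NumberTheory.EllipticCurves.KodairaNeronUnramifiedInertiaProofs
import Literature.NumberTheory.EllipticCurves.GeomPointsGaloisModule
import Literature.NumberTheory.EllipticCurves.GreenbergSelmer
import HarnessLib

/-!
# Additive reduction at `v ∤ m`, ANY level `m ≥ 3`: inertia moves an `m`-torsion point
# (Néron–Ogg–Shafarevich, additive case — composite-level form of `AdditiveReductionRamifiedTorsionProofs`)

`Proofs` file (theorems only, no definitions, no named facts), topic `NumberTheory/EllipticCurves`; sibling of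
`AdditiveReductionRamifiedTorsionProofs` (prime level `p ≥ 3`), whose local theorem
`WeierstrassCurve.exists_inertia_map_ne_of_hasAdditiveReduction` is repeated here VERBATIM for an arbitrary level
`m ≥ 3` prime to `v` — the printed count (Silverman *AEC* VII.6.1/VII.7.1, *ATAEC* IV.9.2 (d)) `m² = #E[m] ≤
[E(K_v^nr) : E₀(K_v^nr)] ≤ 4` at a CUSP never used that `m` is prime.  Consumer: the BSD cell's class (c)-half
(`Summits/…/PrintCf2RubinValueTwoCClassUpsilonInertiaDoor`, door (hNOS) «`E[4]` ramified at an additive `w ∤ 2`»),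
which needs the level `m = 4`.

* `WeierstrassCurve.exists_inertia_map_ne_of_hasAdditiveReduction_of_three_le` — LOCAL (minimal `X/K_v` with additive
  reduction, `m ≥ 3`, `v ∤ m`): some `σ ∈ I_𝔐 ≤ Γ_{K_v}` moves some `P ∈ X(K̄_v)` with `mP = O`;
* `WeierstrassCurve.exists_inertia_smul_ne_of_hasAdditiveReductionAt_of_three_le` — on `localPoints W K_v` for `E/K`;
* `WeierstrassCurve.exists_mem_inertia_smul_geomTorsion_ne_of_hasAdditiveReductionAt` — GLOBAL, with the number-field
  inertia group `GreenbergSelmer.inertia v ≤ Γ_K` (= `res(absInertia K_v)`; `inertia_eq_absInertia`,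
  `resGal_eq_absGaloisRestrict`): some `σ ∈ I_v` moves some `Q ∈ E[m] = E(K̄)[m]` — **`E[m]` is RAMIFIED at `v`**.

References: [SilvermanAEC2009] Thm. VII.6.1, Cor. VII.6.2, proof of Thm. VII.7.1 (PDF pp. 177–179);
[SilvermanATAEC1994] Cor. IV.9.2 (d), Rem. IV.9.2.2, Thm. IV.10.2 (a).
-/

noncomputable section

open scoped Classical NNReal
open NumberField IsDedekindDomain Field Polynomial IsLocalRing

universe u

namespace WeierstrassCurve

open Literature.NumberTheory.EllipticCurves Literature.NumberTheory.EllipticCurves.LocalIndex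
  Literature.NumberTheory.GaloisRepresentations
  Literature.NumberTheory.GaloisRepresentations.IsNonarchimedeanLocalField
  Literature.NumberTheory.DiophantineGeometry Literature.NumberTheory.DiophantineGeometry.TateAlgorithm
  IsDedekindDomain IsDedekindDomain.HeightOneSpectrum

section Local

variable {K : Type u} [Field K] [NumberField K] {v : HeightOneSpectrum (𝓞 K)}
  (X : WeierstrassCurve (v.adicCompletion K))

set_option maxHeartbeats 4000000 in
/-- **Additive reduction at `v ∤ m`, `m ≥ 3`: the inertia group moves an `m`-torsion point** — the tree's
`exists_inertia_map_ne_of_hasAdditiveReduction` (prime level `p ≥ 3`) VERBATIM with the prime `p` replaced by any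
integer `m ≥ 3` with `v ∤ m`: its proof never used primality (the count is `m² ≤ #T ≤ [J(K_v^nr) : E₀] ≤ 4`, absurd for
`m ≥ 3`; `E₀(J ⊗ 𝒪_w)` has no `m`-torsion at a cusp for `|m|_v = 1`).  Setting, steps (1)–(5) and `maxHeartbeats` are
those of the prime version. [cite: SilvermanAEC2009, Thm. VII.6.1 with Cor. VII.6.2 (PDF p. 177) and proof of Thm. VII.7.1 (PDF p. 179)]
[cite: SilvermanATAEC1994, Cor. IV.9.2(d) and Rem. IV.9.2.2 (PDF p. 340)] -/
theorem exists_inertia_map_ne_of_hasAdditiveReduction_of_three_le [hXell : X.IsElliptic]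
    [hadd : X.HasAdditiveReduction (v.adicCompletionIntegers K)]
    (w : Valuation (AlgebraicClosure (v.adicCompletion K)) ℝ≥0)
    (hw : ∀ x, (w x : ℝ) =
      spectralNorm (v.adicCompletion K) (AlgebraicClosure (v.adicCompletion K)) x)
    {𝔐 : Ideal (localAbsIntegers v)} (h𝔐 : 𝔐 ∈ v.localPrimesAbove)
    {m : ℕ} (hm3 : 3 ≤ m) (hmv : (m : 𝓞 K) ∉ v.asIdeal) :
    ∃ σ ∈ 𝔐.inertia (absoluteGaloisGroup (v.adicCompletion K)),
      ∃ P : (X.baseChange (AlgebraicClosure (v.adicCompletion K))).toAffine.Point,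
        m • P = 0 ∧
          Affine.Point.map ((absoluteGaloisGroup.toAlgEquiv _ σ :
              AlgebraicClosure (v.adicCompletion K) ≃ₐ[v.adicCompletion K]
                AlgebraicClosure (v.adicCompletion K)) :
              AlgebraicClosure (v.adicCompletion K) →ₐ[v.adicCompletion K]
                AlgebraicClosure (v.adicCompletion K)) P ≠ P := by
  by_contra hall
  push Not at hall
  -- the setting and steps (1)–(4) of `exists_nsmul_reducesToNonsingular_le_four_of_hasAdditiveReduction`, verbatim
  haveI hXmin : X.IsMinimal (v.adicCompletionIntegers K) := hadd.toIsMinimal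
  -- the classical decidable equality on `K_v^nr`, as in the index theorems of the tree
  letI instDec : DecidableEq (maxUnramified (v.adicCompletion K)) := fun a b => Classical.propDecidable (a = b)
  haveI := isDiscreteValuationRing_unrIntegers hw
  haveI := henselianLocalRing_unrIntegers hw
  haveI : PerfectField (ResidueField (v.adicCompletionIntegers K)) := PerfectField.ofFinite
  obtain ⟨φ, hφ⟩ := exists_ringHom_adicCompletionIntegers_unrIntegers hw
  obtain ⟨ψ, hψ⟩ := exists_ringHom_unrIntegers_integer (w := w)
  have hvR := integers_valuationRing_valuation (Valuation.valuationSubring (Valuation.comap (algebraMap (maxUnramified (v.adicCompletion K)) (AlgebraicClosure (v.adicCompletion K))) w)) (maxUnramified (v.adicCompletion K))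
  have hinjR := IsFractionRing.injective (Valuation.valuationSubring (Valuation.comap (algebraMap (maxUnramified (v.adicCompletion K)) (AlgebraicClosure (v.adicCompletion K))) w)) (maxUnramified (v.adicCompletion K))
  have hX₀K : (X.integralModel (v.adicCompletionIntegers K)).baseChange (v.adicCompletion K) = X :=
    WeierstrassCurve.baseChange_integralModel_eq (v.adicCompletionIntegers K) X
  have hΔ : (X.integralModel (v.adicCompletionIntegers K)).Δ ≠ 0 := fun h0 ↦ by
    refine hXell.isUnit.ne_zero ?_
    rw [← hX₀K]
    change ((X.integralModel (v.adicCompletionIntegers K)).map (algebraMap _ _)).Δ = 0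
    rw [WeierstrassCurve.map_Δ, h0, map_zero]
  /- (1) the index of `E₀` in `J(K_v^nr)`, `J = X₀ ⊗ 𝒪ⁿʳ`, is `≠ 0` and `≤ 4` (additive type) -/
  have hΔm : (X.integralModel (v.adicCompletionIntegers K)).Δ ∈ maximalIdeal (v.adicCompletionIntegers K) := by
    have h := hadd.badReduction
    rw [← WeierstrassCurve.integralModel_Δ_eq (v.adicCompletionIntegers K) X] at h
    exact (valuation_lt_one_iff_mem _ _).mp h
  have hc₄m : (X.integralModel (v.adicCompletionIntegers K)).c₄ ∈ maximalIdeal (v.adicCompletionIntegers K) := by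
    have h := hadd.additiveReduction
    rw [← WeierstrassCurve.integralModel_c₄_eq (v.adicCompletionIntegers K) X] at h
    exact (valuation_lt_one_iff_mem _ _).mp h
  have hmin : ((X.integralModel (v.adicCompletionIntegers K)).baseChange (v.adicCompletion K)).IsMinimal (v.adicCompletionIntegers K) := by
    rw [hX₀K]; exact hXmin
  have hsym : (X.integralModel (v.adicCompletionIntegers K)).kodairaSymbolOfMinimal.IsAdditive :=
    (isAdditive_kodairaSymbolOfMinimal_iff (v.adicCompletion K) hΔ hmin).mpr ⟨hΔm, hc₄m⟩
  have hfin : (((X.integralModel (v.adicCompletionIntegers K)).map φ).nonsingularReductionSubgroup hvR).index ≠ 0 :=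
    index_nonsingularReductionSubgroup_map_ne_zero_of_isAdditive hw hφ _ hΔ hsym
  have hle4 : (((X.integralModel (v.adicCompletionIntegers K)).map φ).nonsingularReductionSubgroup hvR).index ≤ 4 :=
    index_nonsingularReductionSubgroup_map_le_four_of_isAdditive hw hφ _ hΔ hsym
  /- the model `J = X₀ ⊗ 𝒪ⁿʳ`, its base changes to `K_v^nr` and to `𝒪_w`, `K̄_v` -/
  have hJ : ((X.integralModel (v.adicCompletionIntegers K)).map φ).baseChange (maxUnramified (v.adicCompletion K)) = X.baseChange (maxUnramified (v.adicCompletion K)) := by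
    conv_rhs => rw [← hX₀K]
    change ((X.integralModel (v.adicCompletionIntegers K)).map φ).map (algebraMap _ _) =
      ((X.integralModel (v.adicCompletionIntegers K)).map (algebraMap (v.adicCompletionIntegers K) (v.adicCompletion K))).map (algebraMap (v.adicCompletion K) (maxUnramified (v.adicCompletion K)))
    rw [WeierstrassCurve.map_map, WeierstrassCurve.map_map]
    congr 1
    refine RingHom.ext fun a ↦ Subtype.ext ?_
    change (((φ a : (Valuation.valuationSubring (Valuation.comap (algebraMap (maxUnramified (v.adicCompletion K)) (AlgebraicClosure (v.adicCompletion K))) w))) : (maxUnramified (v.adicCompletion K))) : (AlgebraicClosure (v.adicCompletion K))) = ((algebraMap (v.adicCompletion K) (maxUnramified (v.adicCompletion K)) (algebraMap (v.adicCompletionIntegers K) (v.adicCompletion K) a) : (maxUnramified (v.adicCompletion K))) : (AlgebraicClosure (v.adicCompletion K)))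
    rw [hφ, IntermediateField.coe_algebraMap_apply]
    rfl
  have hW₀ : (((X.integralModel (v.adicCompletionIntegers K)).map φ).map ψ).baseChange (AlgebraicClosure (v.adicCompletion K)) = X.baseChange (AlgebraicClosure (v.adicCompletion K)) := by
    conv_rhs => rw [← hX₀K]
    change (((X.integralModel (v.adicCompletionIntegers K)).map φ).map ψ).map (algebraMap _ _) =
      ((X.integralModel (v.adicCompletionIntegers K)).map (algebraMap (v.adicCompletionIntegers K) (v.adicCompletion K))).map (algebraMap (v.adicCompletion K) (AlgebraicClosure (v.adicCompletion K)))
    rw [WeierstrassCurve.map_map, WeierstrassCurve.map_map, WeierstrassCurve.map_map]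
    congr 1
    refine RingHom.ext fun a ↦ ?_
    change ((ψ (φ a) : w.integer) : (AlgebraicClosure (v.adicCompletion K))) = algebraMap (v.adicCompletion K) (AlgebraicClosure (v.adicCompletion K)) (algebraMap (v.adicCompletionIntegers K) (v.adicCompletion K) a)
    rw [hψ, hφ]
    rfl
  -- the residue field of `𝒪ⁿʳ` embeds into that of `𝒪_w`
  haveI hψloc : IsLocalHom ψ := ⟨fun a ha ↦ by
    by_contra hna
    have hmem : a ∈ maximalIdeal (Valuation.valuationSubring (Valuation.comap (algebraMap (maxUnramified (v.adicCompletion K)) (AlgebraicClosure (v.adicCompletion K))) w)) :=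
      (IsLocalRing.mem_maximalIdeal _).mpr (mem_nonunits_iff.mpr hna)
    have := (map_mem_maximalIdeal_integer_iff hψ a).mpr hmem
    exact (mem_nonunits_iff.mp ((IsLocalRing.mem_maximalIdeal _).mp this)) ha⟩
  have hκ : (((X.integralModel (v.adicCompletionIntegers K)).map φ).map ψ).map (residue w.integer) =
      ((((X.integralModel (v.adicCompletionIntegers K)).map φ).map (residue (Valuation.valuationSubring (Valuation.comap (algebraMap (maxUnramified (v.adicCompletion K)) (AlgebraicClosure (v.adicCompletion K))) w)))).map
        (IsLocalRing.ResidueField.map ψ)) := by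
    simp only [WeierstrassCurve.map_map]
    congr 1
  /- the maps on points: `J(K_v^nr) ≃ X(K_v^nr) → X(K̄_v)` -/
  set e₁ := WeierstrassCurve.Affine.Point.congrEquiv hJ with he₁
  set ι : (X.baseChange (maxUnramified (v.adicCompletion K))).toAffine.Point →+ (X.baseChange (AlgebraicClosure (v.adicCompletion K))).toAffine.Point :=
    WeierstrassCurve.Affine.Point.map (W' := X)
      (IsScalarTower.toAlgHom (v.adicCompletion K) (maxUnramified (v.adicCompletion K)) (AlgebraicClosure (v.adicCompletion K))) with hι
  -- (3) `I_𝔐`-fixed points of `X(K̄_v)` come from `X(K_v^nr)` (the tree's exported Step (3))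
  have hsurj : ∀ P : (X.baseChange (AlgebraicClosure (v.adicCompletion K))).toAffine.Point,
      (∀ σ ∈ 𝔐.inertia (absoluteGaloisGroup (v.adicCompletion K)),
        WeierstrassCurve.Affine.Point.map
          ((absoluteGaloisGroup.toAlgEquiv _ σ : (AlgebraicClosure (v.adicCompletion K)) ≃ₐ[(v.adicCompletion K)] (AlgebraicClosure (v.adicCompletion K))) : (AlgebraicClosure (v.adicCompletion K)) →ₐ[(v.adicCompletion K)] (AlgebraicClosure (v.adicCompletion K))) P = P) →
        ∃ Q, ι Q = P := fun P hP ↦ by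
    rw [hι]; exact X.exists_map_maxUnramified_eq_of_forall_inertia w hw h𝔐 P hP
  -- (4) `E₀` of `J` over `𝒪ⁿʳ` maps into `E₀` of `X` over `𝒪_w`
  have hE₀ : ∀ Q : (((X.integralModel (v.adicCompletionIntegers K)).map φ).baseChange (maxUnramified (v.adicCompletion K))).toAffine.Point,
      ((X.integralModel (v.adicCompletionIntegers K)).map φ).HasNonsingularReduction Q →
        ReducesToNonsingular w (residue w.integer) (ι (e₁ Q)) := by
    intro Q hQ
    rcases point_cases hvR Q with rfl | ⟨x, y, h, rfl, hx⟩ | ⟨a, b, h, rfl⟩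
    · rw [map_zero, map_zero]; exact reducesToNonsingular_zero
    · have hx' : 1 < w (x : (AlgebraicClosure (v.adicCompletion K))) := not_le.mp fun hle ↦
        (not_mem_range_iff hvR).mpr hx ⟨⟨x, (Valuation.mem_valuationSubring_iff _ _).mpr hle⟩, rfl⟩
      rw [he₁, WeierstrassCurve.Affine.Point.congrEquiv_some]
      exact reducesToNonsingular_of_one_lt hx'
    · have hns := (WeierstrassCurve.hasNonsingularReduction_some_algebraMap_iff hinjR h).mp hQ
      rw [he₁, WeierstrassCurve.Affine.Point.congrEquiv_some]
      -- transport to the `𝒪_w`-model `J ⊗ 𝒪_w` of `X ⊗ K̄ᵥ`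
      rw [← (WeierstrassCurve.Affine.Point.congrEquiv hW₀).apply_symm_apply (ι _),
        reducesToNonsingular_congrEquiv_iff, reducesToNonsingular_iff_hasNonsingularReduction]
      change (((X.integralModel (v.adicCompletionIntegers K)).map φ).map ψ).HasNonsingularReduction
        ((WeierstrassCurve.Affine.Point.congrEquiv hW₀).symm
          (WeierstrassCurve.Affine.Point.some _ _ _))
      rw [WeierstrassCurve.Affine.Point.congrEquiv_symm_some]
      refine Or.inr ⟨ψ a, ψ b, hψ a, hψ b, ?_⟩
      rw [hκ, ← IsLocalRing.ResidueField.map_residue, ← IsLocalRing.ResidueField.map_residue]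
      exact (WeierstrassCurve.Affine.map_nonsingular _
        (IsLocalRing.ResidueField.map ψ).injective _ _).mpr hns
  /- (5) NEW: the count.  `T` = the `m`-torsion of `J(K_v^nr)`; `H = E₀`. -/
  set H := ((X.integralModel (v.adicCompletionIntegers K)).map φ).nonsingularReductionSubgroup hvR with hH
  set T := AddSubgroup.torsionBy
    ((((X.integralModel (v.adicCompletionIntegers K)).map φ).baseChange
      (maxUnramified (v.adicCompletion K))).toAffine.Point) (m : ℤ) with hT
  -- valuations of `m`: `|p|_v = 1` on `K̄_v`
  have hpw : w ((m : ℤ) : AlgebraicClosure (v.adicCompletion K)) = 1 :=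
    spectralValuation_intCast_eq_one hw (n := (m : ℤ)) (by simpa using hmv)
  have hp0 : m ≠ 0 := by omega
  haveI : CharZero (v.adicCompletion K) := charZero_of_injective_algebraMap (algebraMap K _).injective
  haveI : CharZero (AlgebraicClosure (v.adicCompletion K)) :=
    charZero_of_injective_algebraMap (algebraMap (v.adicCompletion K) _).injective
  -- the `𝒪_w`-model `W₀ = J ⊗ 𝒪_w` of `X ⊗ K̄_v` reduces to a CUSP
  have hv0 : w.Integers w.integer := Valuation.integer.integers w
  have T1 : ∀ (a : (v.adicCompletionIntegers K)), a ∈ maximalIdeal (v.adicCompletionIntegers K) →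
      IsLocalRing.residue w.integer (ψ (φ a)) = 0 := by
    intro a ha
    have h1 := (map_mem_maximalIdeal_pow_iff hw hφ a 1).mpr (by rwa [pow_one])
    rw [pow_one] at h1
    exact (IsLocalRing.residue_eq_zero_iff _).mpr ((map_mem_maximalIdeal_integer_iff hψ (φ a)).mpr h1)
  have hΔ0 : IsLocalRing.residue w.integer
      (((X.integralModel (v.adicCompletionIntegers K)).map φ).map ψ).Δ = 0 := by
    rw [WeierstrassCurve.map_Δ, WeierstrassCurve.map_Δ]; exact T1 _ hΔm
  have hc₄0 : IsLocalRing.residue w.integer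
      (((X.integralModel (v.adicCompletionIntegers K)).map φ).map ψ).c₄ = 0 := by
    rw [WeierstrassCurve.map_c₄, WeierstrassCurve.map_c₄]; exact T1 _ hc₄m
  -- the maps `J(K_v^nr) → X(K̄_v)` are injective
  have hinjι' : Function.Injective ι := by rw [hι]; exact WeierstrassCurve.Affine.Point.map_injective _
  have hinj : Function.Injective (fun Q => ι (e₁ Q)) := fun a b hab => e₁.injective (hinjι' hab)
  -- (5a) `T ⊓ H = ⊥`: a `m`-torsion point of `E₀(J)` is `O` (cusp)
  have hTH : ∀ Q, Q ∈ T → Q ∈ H → Q = 0 := by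
    intro Q hQT hQH
    have hpQ : (m : ℤ) • Q = 0 := (Submodule.mem_torsionBy_iff (m : ℤ) Q).mp hQT
    have hred : ReducesToNonsingular w (residue w.integer) (ι (e₁ Q)) := hE₀ Q hQH
    -- read on the `𝒪_w`-model
    set P' := (WeierstrassCurve.Affine.Point.congrEquiv hW₀).symm (ι (e₁ Q)) with hP'
    have hns : (((X.integralModel (v.adicCompletionIntegers K)).map φ).map ψ).HasNonsingularReduction P' := by
      rw [← reducesToNonsingular_iff_hasNonsingularReduction]
      refine (reducesToNonsingular_congrEquiv_iff _ hW₀ P').mp ?_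
      rw [hP', AddEquiv.apply_symm_apply]
      exact hred
    have hpP' : (m : ℤ) • P' = 0 := by
      rw [hP', ← map_zsmul, ← map_zsmul, ← map_zsmul, hpQ, map_zero, map_zero, map_zero]
    have hP'0 : P' = 0 := eq_zero_of_zsmul_eq_zero_of_cusp _ hΔ0 hc₄0 hpw hns hpP'
    have h1 := congrArg (WeierstrassCurve.Affine.Point.congrEquiv hW₀) hP'0
    rw [hP', AddEquiv.apply_symm_apply, map_zero] at h1
    exact hinj (by simpa using h1)
  -- (5b) every point of `X(K̄_v)[p]` comes from `T` (all of it is `I_𝔐`-fixed, by `hall`)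
  have hfinX : Nat.card (AddSubgroup.torsionBy
      ((X.baseChange (AlgebraicClosure (v.adicCompletion K))).toAffine.Point) (m : ℤ)) = m ^ 2 :=
    card_torsionBy_eq_sq (E := X.baseChange (AlgebraicClosure (v.adicCompletion K))) (n := m)
      (by exact_mod_cast hp0)
  have hlift : ∀ P : AddSubgroup.torsionBy
      ((X.baseChange (AlgebraicClosure (v.adicCompletion K))).toAffine.Point) (m : ℤ),
      ∃ Q : T, ι (e₁ (Q : _)) = (P : _) := by
    intro P
    have hpP : m • (P.1 : (X.baseChange (AlgebraicClosure (v.adicCompletion K))).toAffine.Point) = 0 := by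
      have := (Submodule.mem_torsionBy_iff (m : ℤ) P.1).mp P.2
      rwa [natCast_zsmul] at this
    obtain ⟨P₀, hP₀⟩ := hsurj P.1 (fun σ hσ => hall σ hσ P.1 hpP)
    refine ⟨⟨e₁.symm P₀, ?_⟩, by rw [AddEquiv.apply_symm_apply, hP₀]⟩
    refine (Submodule.mem_torsionBy_iff (m : ℤ) _).mpr ?_
    apply hinj
    change ι (e₁ ((m : ℤ) • e₁.symm P₀)) = ι (e₁ 0)
    rw [map_zsmul, map_zsmul, AddEquiv.apply_symm_apply, hP₀, map_zero, map_zero, natCast_zsmul, hpP]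
  choose f hf using hlift
  have hfinj : Function.Injective f := fun P₁ P₂ h => Subtype.ext (by rw [← hf P₁, ← hf P₂, h])
  -- (5c) `T ↪ J(K_v^nr)/H`
  haveI hfinQ : Finite ((((X.integralModel (v.adicCompletionIntegers K)).map φ).baseChange
      (maxUnramified (v.adicCompletion K))).toAffine.Point ⧸ H) :=
    Nat.finite_of_card_ne_zero (by rw [← AddSubgroup.index_eq_card]; exact hfin)
  set g : T → ((((X.integralModel (v.adicCompletionIntegers K)).map φ).baseChange
      (maxUnramified (v.adicCompletion K))).toAffine.Point ⧸ H) :=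
    fun Q => (QuotientAddGroup.mk Q.1 : _ ⧸ H) with hg
  have hginj : Function.Injective g := by
    intro Q₁ Q₂ h
    apply Subtype.ext
    have h' : (QuotientAddGroup.mk Q₁.1 : _ ⧸ H) = QuotientAddGroup.mk Q₂.1 := h
    rw [QuotientAddGroup.eq] at h'
    have hmem : -Q₁.1 + Q₂.1 ∈ T := T.add_mem (T.neg_mem Q₁.2) Q₂.2
    have h0 := hTH _ hmem h'
    rwa [neg_add_eq_zero] at h0
  haveI hfinT : Finite T := Finite.of_injective g hginj
  -- the count: `9 ≤ p² ≤ #T ≤ [J : H] ≤ 4`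
  have h1 : m ^ 2 ≤ Nat.card T := by rw [← hfinX]; exact Nat.card_le_card_of_injective f hfinj
  have h2 : Nat.card T ≤ H.index := by rw [AddSubgroup.index_eq_card]; exact Nat.card_le_card_of_injective g hginj
  have h3 : (9 : ℕ) ≤ m ^ 2 := by nlinarith
  omega

end Local

/-! ### The statements for an elliptic curve over a number field -/

section Global

open Literature.NumberTheory.EllipticCurves Literature.NumberTheory.GaloisRepresentations Field
  IsDedekindDomain.HeightOneSpectrum

variable {K : Type u} [Field K] [NumberField K] {v : HeightOneSpectrum (𝓞 K)}
  (W : WeierstrassCurve K)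

/-- **Additive reduction at `v ∤ m`, `m ≥ 3`: the local inertia group moves an `m`-torsion point of `E(K̄_v)`** —
on `localPoints W K_v`, by transport along the `Γ_{K_v}`-equivariant isomorphism with the minimal model at `v`
(as in the prime version `exists_inertia_smul_ne_of_hasAdditiveReductionAt`).
[cite: SilvermanAEC2009, Thm. VII.6.1 (PDF p. 177) and proof of Thm. VII.7.1 (PDF p. 179)] -/
theorem exists_inertia_smul_ne_of_hasAdditiveReductionAt_of_three_le [W.IsElliptic]
    (hadd : W.HasAdditiveReductionAt v) {m : ℕ} (hm3 : 3 ≤ m) (hmv : (m : 𝓞 K) ∉ v.asIdeal)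
    {w : Valuation (AlgebraicClosure (v.adicCompletion K)) ℝ≥0}
    (hw : ∀ x, (w x : ℝ) =
      spectralNorm (v.adicCompletion K) (AlgebraicClosure (v.adicCompletion K)) x)
    {𝔐 : Ideal v.localAbsIntegers} (h𝔐 : 𝔐 ∈ v.localPrimesAbove) :
    ∃ σ ∈ 𝔐.inertia (absoluteGaloisGroup (v.adicCompletion K)),
      ∃ Q : localPoints W (v.adicCompletion K), m • Q = 0 ∧ σ • Q ≠ Q := by
  set X := W.localMinimalModel v with hXdef
  haveI : X.IsElliptic := W.isElliptic_localMinimalModel v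
  haveI : X.HasAdditiveReduction (v.adicCompletionIntegers K) := hadd
  obtain ⟨σ, hσ, P, hpP, hσP⟩ :=
    X.exists_inertia_map_ne_of_hasAdditiveReduction_of_three_le w hw h𝔐 hm3 hmv
  obtain ⟨C, hC⟩ := W.exists_variableChange_smul_eq_localMinimalModel v
  obtain ⟨Φ, hΦ⟩ := W.exists_addEquiv_localPoints_of_smul_eq v hC
  refine ⟨σ, hσ, Φ.symm P, ?_, fun h ↦ hσP ?_⟩
  · apply Φ.injective; rw [map_nsmul, AddEquiv.apply_symm_apply, hpP, map_zero]
  · have := hΦ σ (Φ.symm P)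
    rw [h, AddEquiv.apply_symm_apply] at this; exact this.symm

/-- **`E[m]` is RAMIFIED at an additive place `v ∤ m`, `m ≥ 3`** — with the number-field inertia group
`I_v = GreenbergSelmer.inertia v ≤ Γ_K` (the restriction of `absInertia K_v = I_𝔐`, `inertia_eq_absInertia`, along the
chosen embedding `K̄ → K̄_v`; `resGal = absGaloisRestrict`): some `σ ∈ I_v` moves some `Q ∈ E[m] = E(K̄)[m]`.
[cite: SilvermanAEC2009, proof of Thm. VII.7.1 (PDF p. 179)] [cite: SilvermanATAEC1994, Thm. IV.10.2(a) (PDF pp. 358–359)] -/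
theorem exists_mem_inertia_smul_geomTorsion_ne_of_hasAdditiveReductionAt [W.IsElliptic]
    (hadd : W.HasAdditiveReductionAt v) {m : ℕ} (hm3 : 3 ≤ m) (hmv : (m : 𝓞 K) ∉ v.asIdeal) :
    ∃ σ ∈ GreenbergSelmer.inertia v, ∃ Q : geomTorsion W (m : ℤ), σ • Q ≠ Q := by
  have hm0 : m ≠ 0 := by omega
  obtain ⟨w, hw⟩ := v.exists_spectralValuation
  obtain ⟨𝔐, h𝔐⟩ := v.localPrimesAbove_nonempty
  obtain ⟨τ, hτ, Q, hpQ, hτQ⟩ :=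
    W.exists_inertia_smul_ne_of_hasAdditiveReductionAt_of_three_le hadd hm3 hmv hw h𝔐
  -- the moved `m`-torsion point comes from `E(K̄)`
  obtain ⟨P₀, hpP₀, hP₀Q⟩ := exists_pointsMapOfEmb_eq_of_nsmul_eq_zero W
    (closureEmb (K := K) (v.adicCompletion K)) hm0 hpQ
  have hmem : P₀ ∈ geomTorsion W (m : ℤ) :=
    (Submodule.mem_torsionBy_iff _ _).mpr (show (m : ℤ) • P₀ = 0 by rw [natCast_zsmul, hpP₀])
  -- `τ ∈ I_𝔐 = absInertia K_v`, so `res τ ∈ I_v`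
  have hτ' : τ ∈ absInertia (v.adicCompletion K) := (inertia_eq_absInertia hw h𝔐) ▸ hτ
  refine ⟨resGal (K := K) (v.adicCompletion K) τ, ?_, ⟨P₀, hmem⟩, fun h ↦ hτQ ?_⟩
  · rw [resGal_eq_absGaloisRestrict]
    exact Subgroup.mem_map_of_mem _ hτ'
  have h' := congrArg
    (fun R : geomTorsion W (m : ℤ) ↦ pointsMap W (v.adicCompletion K) (R : geomPoints W)) h
  simp only [Literature.NumberTheory.EllipticCurves.AddSubgroup.torsionBy.coe_smul,
    pointsMap_smul] at h'
  rw [← hP₀Q]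
  exact h'

end Global

end WeierstrassCurve
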